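import Summits.BirchSwinnertonDyer.BirchSwinnertonDyer.Theorems.Rank2ObservatoryRank3Census
import Summits.BirchSwinnertonDyer.BirchSwinnertonDyer.Theorems.Rank2ObservatoryRank3FullTwoTorsion
import Summits.BirchSwinnertonDyer.BirchSwinnertonDyer.Theorems.Rank2ObservatoryRank3CMCensus
import Literature.NumberTheory.EllipticCurves.BSDQuadraticDescentPeriodEliminationProofs
import Literature.NumberTheory.EllipticCurves.CoatesLiTianZhai2015.QuadraticTwistsX049
import Literature.NumberTheory.EllipticCurves.ComplexMultiplicationBurungaleFlachProofs
import HarnessLib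

/-!
# BirchSwinnertonDyer — rank ≥ 2 observatory: THE ARCHIMEDEAN COMPONENT COUNT OF THE 9 487 RANK-3 CURVES — `c_∞(E) = #π₀(E(ℝ))`
# is `2` on exactly `4 340` rank-3 census curves (`Δ > 0`) and `1` on exactly `5 147` (`Δ < 0`), decided in the kernel, hypothesis-free;
# so the BSD period `Ω(E) = ∫_{E(ℝ)}|ω|` of the census (minimal) model is TWICE the least positive real period on `4 340` rows and
# EQUAL to it on `5 147`

HONEST FRAMING: per-curve certified theorems and census instruments; no claim on BSD in rank ≥ 2.

## What this file does (zero numerics, zero new data; ONE definition-free file, two linear kernel walks)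

The archimedean factor of the Birch–Swinnerton-Dyer leading term is the real period `Ω(E) = ∫_{E(ℝ)}|ω|` of a global
minimal model (`WeierstrassCurve.realPeriodRat`; every census model is globally minimal by kernel certificate, KCI row on
minimality), and `Ω(E) = c_∞(E) · Ω_∞(E)` where `Ω_∞(E)` is the least positive real period of the Néron lattice and
`c_∞(E) = #π₀(E(ℝ)) ∈ {1, 2}` is the number of connected components of the real locus: `2` if `Δ(E) > 0`, `1` if `Δ(E) < 0`
(Cremona, *Algorithms* §3.7; Silverman AEC V.2 / C.16). The two conventions for "the real period" found in tables and
engines (`Ω` versus `Ω_∞`; Cremona's `allbsd` column and the LMFDB list `Ω = c_∞ · Ω_∞`) differ by exactly this factor, row by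
row. The tree has all three notions: `WeierstrassCurve.numRealComponents` (`RealPeriod.lean`: `if 0 < Δ then 2 else 1` for a
model over `ℝ`), `WeierstrassCurve.numRealComponents_baseChange_real` (PROVED: for `W/ℚ`, `c_∞(W ⊗ ℝ) = if 0 < Δ(W) then 2 else 1`),
`CoatesLiTianZhai2015.leastRealPeriod W = Ω(W) / c_∞(W)` with the PROVED rearrangement
`realPeriodRat_eq_numRealComponents_mul_leastRealPeriod : Ω(W) = c_∞(W) · Ω_∞(W)`, and `realPeriodRat_pos_holds` (PROVED, `Ω(W) > 0`
for elliptic `W`).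

On a census row `r : Rank3Row` the discriminant of the model is the row's INTEGER `r.delta` (`Rank3Row.curve_Δ`, kernel-evaluable),
so `c_∞` is decided by the sign of one integer per row:

* §1 (general per-row glue, by name): `Rank3Row.baseChange_real_Δ : Δ(r.curve ⊗ ℝ) = r.delta`; `Rank3Row.numRealComponents_eq :
  c_∞ = if 0 < r.delta then 2 else 1`; `…_eq_two_of_delta_pos`, `…_eq_one_of_delta_nonpos`; the period readings
  `Rank3Row.realPeriodRat_eq_two_mul_leastRealPeriod_of_delta_pos : Ω = 2 · Ω_∞` and `…_eq_leastRealPeriod_of_delta_nonpos : Ω = Ω_∞`;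
  `Rank3Row.leastRealPeriod_pos : 0 < Ω_∞` for an elliptic row; and the BSD quantity with the factor made explicit,
  `Rank3Row.bsdRHS_eq_of_delta_pos : bsdRHS = 2 · (#Ш · Reg · Ω_∞ · ∏ c_p / T²)` (`Δ > 0`) / `Rank3Row.bsdRHS_eq_of_delta_nonpos` (`Δ ≤ 0`).
* §2 (table): every row has `r.delta ≠ 0` (`delta_ne_zero_of_mem`, from the row check, no walk), so the rows split into `Δ > 0` and
  `Δ < 0` (`delta_pos_or_neg_of_mem`); KERNEL CENSUS (two linear walks, `decide +kernel`): `rank3Table.countP (0 < ·.delta) = 4340`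
  (`rank3Table_countP_delta_pos`) and `rank3Table.countP (·.delta < 0) = 5147` (`rank3Table_countP_delta_neg`), `4340 + 5147 = 9487`.
* §3 (strata, tiny kernel walks): all `20` full-2-torsion rows (`rank3FullTwoTorsionRows`, KCI row 44) have `Δ > 0`, hence `c_∞ = 2`
  (`rank3FullTwoTorsionRows_delta_pos`, `Rank3Row.numRealComponents_eq_two_of_mem_fullTwoTorsionRows`) — as it must be: `E[2] ⊆ E(ℚ) ⊆ E(ℝ)`
  forces three real `2`-division roots; of the six CM rows (`cmRows`, KCI row 48) exactly `430336d1` has `Δ > 0` (`cmRows_delta_pos`); row `0`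
  (`5077a1`, `Δ = 5077 > 0`) has `c_∞ = 2` (`rank3Table_head_delta_pos`), so Cremona's tabulated `Ω(5077a1) = 4.15168…` is twice the least
  real period.
* §4 summary `rank3_realComponents`.

ENGINE-SIDE (not in the kernel; `sat2-r3/g59/scope59f_arch.py`, seconds): among the `966` rows with exactly one rational `2`-torsion point
`Δ > 0` on `692` and `Δ < 0` on `274`; among the `8 501` rows without rational `2`-torsion `Δ > 0` on `3 628`; `Δ` is a square on `50` rows
(the `20` full-2-torsion rows among them).

NOT claimed: any VALUE of `Ω`, `Ω_∞`, `Reg`, `#Ш`, `c_p`; nothing about `E(ℝ)` beyond the component count `c_∞` as DEFINED in the tree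
(`numRealComponents` is the tree's definition by the sign of `Δ`; its identification with `#π₀(E(ℝ))` and of `leastRealPeriod` with the
least positive real period of the period lattice are the tree's documented conventions, Cremona §3.7, not re-proved here); nothing on BSD.

Sources: [cite: CremonaAlgorithms1997, §3.7 (real period, number of real components)]; [cite: SilvermanAEC2009, C.16 (Ω in the BSD formula)];
[cite: CoatesLiTianZhai2015, §1 (1.3) (the factor c_∞)]; [cite: Wiles2000, §1 formula (4)].
-/

namespace Summit.BirchSwinnertonDyer.BirchSwinnertonDyer.Rank2Observatory

open Literature Literature.NumberTheory.EllipticCurves WeierstrassCurve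
open Literature.NumberTheory.EllipticCurves.CoatesLiTianZhai2015

/-! ## §1 Per-row glue (general `r : Rank3Row`, by name) -/

namespace Rank3Row

variable (r : Rank3Row)

/-- The discriminant of the real base change of the row's model is the row's integer `Δ`. [cite: CremonaAlgorithms1997, §3.7] -/
theorem baseChange_real_Δ : (r.curve.baseChange ℝ).Δ = (r.delta : ℝ) := by
  have h : (r.curve.baseChange ℝ).Δ = (r.curve.Δ : ℝ) := by
    simp [WeierstrassCurve.baseChange, WeierstrassCurve.map_Δ]
  rw [h, curve_Δ]; push_cast; rfl

/-- `c_∞(E) = 2` if `Δ > 0`, else `1` — on a census row, by the sign of the integer `r.delta`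
(by name `numRealComponents_baseChange_real`). [cite: CremonaAlgorithms1997, §3.7] -/
theorem numRealComponents_eq :
    (r.curve.baseChange ℝ).numRealComponents = if 0 < r.delta then 2 else 1 := by
  rw [WeierstrassCurve.numRealComponents_baseChange_real, curve_Δ]
  simp only [Int.cast_pos]

/-- `Δ > 0 ⇒ c_∞ = 2` (two real components). [cite: CremonaAlgorithms1997, §3.7] -/
theorem numRealComponents_eq_two_of_delta_pos (h : 0 < r.delta) :
    (r.curve.baseChange ℝ).numRealComponents = 2 := by
  rw [numRealComponents_eq, if_pos h]

/-- `Δ ≤ 0 ⇒ c_∞ = 1` (one real component; `Δ = 0` never happens on the table). [cite: CremonaAlgorithms1997, §3.7] -/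
theorem numRealComponents_eq_one_of_delta_nonpos (h : r.delta ≤ 0) :
    (r.curve.baseChange ℝ).numRealComponents = 1 := by
  rw [numRealComponents_eq, if_neg (not_lt.mpr h)]

/-- `Δ > 0`: the BSD period of the row's model is TWICE the least positive real period, `Ω = 2 · Ω_∞`
(by name `realPeriodRat_eq_numRealComponents_mul_leastRealPeriod`). [cite: CoatesLiTianZhai2015, §1 (1.3)] -/
theorem realPeriodRat_eq_two_mul_leastRealPeriod_of_delta_pos (h : 0 < r.delta) :
    r.curve.realPeriodRat = 2 * leastRealPeriod r.curve := by
  have := realPeriodRat_eq_numRealComponents_mul_leastRealPeriod r.curve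
  rw [r.numRealComponents_eq_two_of_delta_pos h] at this
  exact_mod_cast this

/-- `Δ ≤ 0`: the BSD period of the row's model IS the least positive real period, `Ω = Ω_∞`. [cite: CoatesLiTianZhai2015, §1 (1.3)] -/
theorem realPeriodRat_eq_leastRealPeriod_of_delta_nonpos (h : r.delta ≤ 0) :
    r.curve.realPeriodRat = leastRealPeriod r.curve := by
  have := realPeriodRat_eq_numRealComponents_mul_leastRealPeriod r.curve
  rw [r.numRealComponents_eq_one_of_delta_nonpos h] at this
  simpa using this

/-- `Ω_∞ > 0` for an elliptic row (`realPeriodRat_pos_holds`, `numRealComponents_pos`). [cite: CremonaAlgorithms1997, §3.7] -/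
theorem leastRealPeriod_pos [r.curve.IsElliptic] : 0 < leastRealPeriod r.curve := by
  unfold leastRealPeriod
  have hΩ : 0 < r.curve.realPeriodRat := r.curve.realPeriodRat_pos_holds
  have hc : (0 : ℝ) < ((r.curve.baseChange ℝ).numRealComponents : ℝ) := by
    exact_mod_cast WeierstrassCurve.numRealComponents_pos _
  exact div_pos hΩ hc

/-- `Δ > 0`: the BSD quantity of the row's model with the archimedean factor explicit,
`#Ш · Reg · Ω · ∏ c_p / T² = 2 · (#Ш · Reg · Ω_∞ · ∏ c_p / T²)`. [cite: Wiles2000, §1 formula (4)] -/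
theorem bsdRHS_eq_of_delta_pos (h : 0 < r.delta) :
    r.curve.bsdRHS = 2 * ((r.curve.shaOrder : ℝ) * r.curve.regulator * leastRealPeriod r.curve *
      (r.curve.tamagawaProduct : ℝ) / (r.curve.torsionOrder : ℝ) ^ 2) := by
  unfold WeierstrassCurve.bsdRHS
  rw [r.realPeriodRat_eq_two_mul_leastRealPeriod_of_delta_pos h]
  ring

/-- `Δ ≤ 0`: the BSD quantity of the row's model reads `#Ш · Reg · Ω_∞ · ∏ c_p / T²` (no factor `2`). [cite: Wiles2000, §1 formula (4)] -/
theorem bsdRHS_eq_of_delta_nonpos (h : r.delta ≤ 0) :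
    r.curve.bsdRHS = (r.curve.shaOrder : ℝ) * r.curve.regulator * leastRealPeriod r.curve *
      (r.curve.tamagawaProduct : ℝ) / (r.curve.torsionOrder : ℝ) ^ 2 := by
  unfold WeierstrassCurve.bsdRHS
  rw [r.realPeriodRat_eq_leastRealPeriod_of_delta_nonpos h]

end Rank3Row

/-! ## §2 The table: partition by the sign of `Δ` and the kernel census -/

/-- Every census row has `Δ ≠ 0` (the row check; no walk). [folklore] -/
theorem delta_ne_zero_of_mem {r : Rank3Row} (hr : r ∈ rank3Table) : r.delta ≠ 0 :=
  (r.check_spec (check_of_mem hr)).1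

/-- Every census row has `Δ > 0` or `Δ < 0`. [folklore] -/
theorem delta_pos_or_neg_of_mem {r : Rank3Row} (hr : r ∈ rank3Table) : 0 < r.delta ∨ r.delta < 0 := by
  rcases lt_trichotomy r.delta 0 with h | h | h
  · exact Or.inr h
  · exact absurd h (delta_ne_zero_of_mem hr)
  · exact Or.inl h

/-- Per row of the table: `c_∞ = 2 ∨ c_∞ = 1` according to the sign of `r.delta` (the decision is `decide` on the row's integer).
[cite: CremonaAlgorithms1997, §3.7] -/
theorem numRealComponents_of_mem {r : Rank3Row} (hr : r ∈ rank3Table) :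
    (0 < r.delta ∧ (r.curve.baseChange ℝ).numRealComponents = 2) ∨
      (r.delta < 0 ∧ (r.curve.baseChange ℝ).numRealComponents = 1) := by
  rcases delta_pos_or_neg_of_mem hr with h | h
  · exact Or.inl ⟨h, r.numRealComponents_eq_two_of_delta_pos h⟩
  · exact Or.inr ⟨h, r.numRealComponents_eq_one_of_delta_nonpos h.le⟩

/-- `Ω_∞ > 0` on every census row. [cite: CremonaAlgorithms1997, §3.7] -/
theorem leastRealPeriod_pos_of_mem {r : Rank3Row} (hr : r ∈ rank3Table) : 0 < leastRealPeriod r.curve := by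
  haveI := isElliptic_of_mem hr
  exact r.leastRealPeriod_pos

/-- KERNEL CENSUS (one linear walk over the `9 487` rows): exactly `4 340` rows have `Δ > 0` (two real components, `c_∞ = 2`).
[cite: CremonaAlgorithms1997, Tables] -/
theorem rank3Table_countP_delta_pos : rank3Table.countP (fun r => decide (0 < r.delta)) = 4340 := by
  decide +kernel

/-- KERNEL CENSUS (one linear walk): exactly `5 147` rows have `Δ < 0` (one real component, `c_∞ = 1`). [cite: CremonaAlgorithms1997, Tables] -/
theorem rank3Table_countP_delta_neg : rank3Table.countP (fun r => decide (r.delta < 0)) = 5147 := by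
  decide +kernel

/-- The two classes exhaust the table: `4 340 + 5 147 = 9 487 = rank3Table.length`. [cite: CremonaAlgorithms1997, Tables] -/
theorem rank3Table_countP_delta_pos_add_neg :
    rank3Table.countP (fun r => decide (0 < r.delta)) + rank3Table.countP (fun r => decide (r.delta < 0)) = rank3Table.length := by
  rw [rank3Table_countP_delta_pos, rank3Table_countP_delta_neg, rank3Table_length]

/-! ## §3 Strata (tiny kernel walks) -/

/-- All `20` full-2-torsion rows have `Δ > 0` (kernel, 20 rows) — necessarily: the three `2`-division roots are rational, hence real.
[cite: CremonaAlgorithms1997, §3.7] -/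
theorem rank3FullTwoTorsionRows_delta_pos : ∀ r ∈ rank3FullTwoTorsionRows, 0 < r.delta := by
  decide

/-- Hence `c_∞ = 2` and `Ω = 2 · Ω_∞` on each of the `20` full-2-torsion rows. [cite: CremonaAlgorithms1997, §3.7] -/
theorem Rank3Row.numRealComponents_eq_two_of_mem_fullTwoTorsionRows {r : Rank3Row} (hr : r ∈ rank3FullTwoTorsionRows) :
    (r.curve.baseChange ℝ).numRealComponents = 2 ∧ r.curve.realPeriodRat = 2 * leastRealPeriod r.curve :=
  ⟨r.numRealComponents_eq_two_of_delta_pos (rank3FullTwoTorsionRows_delta_pos r hr),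
    r.realPeriodRat_eq_two_mul_leastRealPeriod_of_delta_pos (rank3FullTwoTorsionRows_delta_pos r hr)⟩

/-- The six CM rows (KCI row 48): `Δ > 0` exactly on `430336d1` (`j = 1728`, `c₄ > 0`); the four `j = 0` rows and `430336d2` have `Δ < 0`
(kernel, 6 rows). [cite: CremonaAlgorithms1997, Tables] -/
theorem cmRows_delta_pos : cmRows.map (fun r => (r.label, decide (0 < r.delta))) =
    [("309123a1", false), ("309123a2", false), ("430336d1", true), ("430336d2", false), ("471969b1", false), ("471969b2", false)] := by
  decide +kernel

/-- Row `0` of the table is `5077a1` and has `Δ > 0` (`Δ = 5077`): `c_∞ = 2`, so its BSD period is twice the least real period.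
[cite: BuhlerGrossZagier1985] -/
theorem rank3Table_head_delta_pos : (rank3Table.head?.map fun r => (r.label, r.delta)) = some ("5077a1", 5077) := by
  decide +kernel

/-! ## §4 Summary -/

/-- **The archimedean component count of the rank-3 table.** Hypothesis-free: `c_∞ = 2` on exactly `4 340` rows and `c_∞ = 1` on exactly
`5 147` rows (by the sign of `Δ`), the classes exhaust the `9 487` rows; per row `Ω = 2 · Ω_∞` resp. `Ω = Ω_∞` with `Ω_∞ > 0`; all `20`
full-2-torsion rows lie in the first class. HONEST FRAMING: per-curve certified theorems and census instruments; no claim on BSD in rank ≥ 2.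
[cite: CremonaAlgorithms1997, §3.7] -/
theorem rank3_realComponents :
    rank3Table.countP (fun r => decide (0 < r.delta)) = 4340 ∧
    rank3Table.countP (fun r => decide (r.delta < 0)) = 5147 ∧
    rank3Table.length = 9487 ∧
    (∀ r ∈ rank3Table,
      (0 < r.delta ∧ (r.curve.baseChange ℝ).numRealComponents = 2 ∧ r.curve.realPeriodRat = 2 * leastRealPeriod r.curve) ∨
      (r.delta < 0 ∧ (r.curve.baseChange ℝ).numRealComponents = 1 ∧ r.curve.realPeriodRat = leastRealPeriod r.curve)) ∧
    (∀ r ∈ rank3Table, 0 < leastRealPeriod r.curve) ∧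
    (∀ r ∈ rank3FullTwoTorsionRows, (r.curve.baseChange ℝ).numRealComponents = 2) := by
  refine ⟨rank3Table_countP_delta_pos, rank3Table_countP_delta_neg, rank3Table_length, ?_, ?_, ?_⟩
  · intro r hr
    rcases delta_pos_or_neg_of_mem hr with h | h
    · exact Or.inl ⟨h, r.numRealComponents_eq_two_of_delta_pos h, r.realPeriodRat_eq_two_mul_leastRealPeriod_of_delta_pos h⟩
    · exact Or.inr ⟨h, r.numRealComponents_eq_one_of_delta_nonpos h.le, r.realPeriodRat_eq_leastRealPeriod_of_delta_nonpos h.le⟩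
  · intro r hr
    exact leastRealPeriod_pos_of_mem hr
  · intro r hr
    exact (Rank3Row.numRealComponents_eq_two_of_mem_fullTwoTorsionRows hr).1

end Summit.BirchSwinnertonDyer.BirchSwinnertonDyer.Rank2Observatory
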